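import Literature.Analysis.FluidPDE.ClassicalSuitableRegionEnergy
import Literature.Analysis.FluidPDE.SereginEpsilonRegularityHolds
import HarnessLib

/-!
# The CKN dissipation criterion at the top centre of a cylinder, for classical solutions

Analysis/FluidPDE proofs-layer file (theorems only). The tree's backward-cylinder form of the
Caffarelli–Kohn–Nirenberg ε-regularity criterion, `seregin2014_thm14_holds` (Seregin 2014,
Ch. 6, Thm. 1.4: for a suitable weak solution `(v, q)` in the unit parabolic cylinder
`Q = Q(0, 1) = (−1, 0) × B₁`, `sup_{0<r<1} E(r) < ε ⇒ v ∈ L^∞(Q(ϱ))` for some `ϱ ∈ (0,1)`,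
`E(r) = r⁻¹ ∫∫_{Q(r)} |∇v|²`), is specialised to **classical** solutions in the open cylinder —
the setting of local regularity criteria for smooth solutions which may blow up at the top
boundary `t = 0` (e.g. Pineau–Vicol 2026, Prop. 9.5 and Thm. 1.9). For a classical solution
`(v, q)` of the unforced system (`ν = 1`) on `Q(0,1)` (`IsClassicalNSSolutionOnRegion`, smooth on
the open cylinder only):

* the interior part of suitability is automatic
  (`IsClassicalNSSolutionOnRegion.isSuitableWeakSolutionOn`, `ClassicalSuitableRegionEnergy`),
  and the classical slice gradient `Dₓv` is a weak spatial gradient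
  (`IsClassicalNSSolutionOnRegion.hasWeakSpatialGradientOn`, `ClassicalSuitableRegion`);
* so `(v, q)` is a suitable weak solution **in the parabolic ball** `Q(0,1)` in the sense of the
  criterion (`IsSuitableWeakSolutionInBall 1 0 v q`, Albritton–Barker 2019, Def. 2.1: plus the
  global classes `v ∈ L^∞_t L²_x(Q)`, `∇v ∈ L²(Q)`, `q ∈ L^{3/2}(Q)` up to the top) as soon as the
  three global integrability conditions hold — `isSuitableWeakSolutionInBall_of_classical`;
* **regularity at the top centre** (`exists_bound_near_top_of_classical_of_cknE_lt`): there is a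
  universal `ε > 0` such that, under these conditions and `sup_{0<r<1} E(r) < ε` for the classical
  dissipation `E(r) = cknE r 0 (Dₓv)`, `v` is **bounded pointwise** on some smaller cylinder
  `Q(ϱ) = (−ϱ², 0) × B_ϱ`, `0 < ϱ < 1` (essential boundedness from the criterion, upgraded to a
  pointwise bound by continuity on the open cylinder, `exists_forall_norm_le_of_eLpNorm_top_lt_top`).

This is exactly the use of "[11]" in Pineau–Vicol 2026, proof of Prop. 9.5 (p. 33: "We are thus
justified to invoke the ε-regularity theorem for suitable weak solutions [11, 44, 41, 40]: there
exists a universal constant `ε_* > 0` such that if `limsup_{r→0⁺} r⁻¹∫_{Q_r}|∇u|² ≤ ε_*`, then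
`(0,0)` is a regular point"), in the tree's `sup_{0<r<1}` form after a parabolic zoom.

## References

* G. Seregin, *Lecture Notes on Regularity Theory for the Navier–Stokes Equations* (2014),
  Ch. 6, Thm. 1.4. [Seregin2014]
* L. Caffarelli, R. Kohn, L. Nirenberg, Comm. Pure Appl. Math. 35 (1982), Prop. 2.
  [CaffarelliKohnNirenberg1982]
* D. Albritton, T. Barker, Arch. Ration. Mech. Anal. 232 (2019), Def. 2.1. [AlbrittonBarker2019]
* B. Pineau, V. Vicol, arXiv:2607.09619 (2026), proof of Prop. 9.5 (p. 33). [PineauVicol2026]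
-/

noncomputable section

open Set Function Filter MeasureTheory TopologicalSpace Metric
open _root_.Topology
open scoped ENNReal NNReal

namespace Literature.Analysis.FluidPDE

/-! ### Essential bounds of continuous functions on open sets are pointwise bounds -/

section EssSup

variable {X : Type*} [TopologicalSpace X] [MeasurableSpace X] [OpensMeasurableSpace X]
  {μ : Measure X} [μ.IsOpenPosMeasure]
variable {F : Type*} [NormedAddCommGroup F]

/-- **A function continuous on an open set is pointwise bounded there by its `L^∞` norm** (for a
measure charging nonempty open sets): `‖g x‖ₑ ≤ ‖g‖_{L^∞(U, μ)}` for `x ∈ U`. Generic form of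
the tree's `enorm_le_eLpNorm_top_of_continuousOn` (`Ferrari1993CommutatorTermBounds`, stated on
`ℝ³`). [folklore] -/
theorem enorm_le_eLpNorm_top_restrict_of_continuousOn {U : Set X} (hU : IsOpen U) {g : X → F}
    (hg : ContinuousOn g U) {x : X} (hx : x ∈ U) : ‖g x‖ₑ ≤ eLpNorm g ⊤ (μ.restrict U) := by
  by_contra h
  push Not at h
  set c := eLpNorm g ⊤ (μ.restrict U) with hc
  have hopen : IsOpen (U ∩ g ⁻¹' {z | c < ‖z‖ₑ}) :=
    hg.isOpen_inter_preimage hU (isOpen_lt continuous_const continuous_enorm)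
  have hxS : x ∈ U ∩ g ⁻¹' {z | c < ‖z‖ₑ} := ⟨hx, h⟩
  have hpos : 0 < μ (U ∩ g ⁻¹' {z | c < ‖z‖ₑ}) := hopen.measure_pos μ ⟨x, hxS⟩
  have hae : ∀ᵐ y ∂(μ.restrict U), ‖g y‖ₑ ≤ c := by
    rw [hc, eLpNorm_exponent_top]; exact ae_le_eLpNormEssSup
  have hnull : μ.restrict U {y | c < ‖g y‖ₑ} = 0 := by
    rw [ae_iff] at hae
    simpa only [not_le] using hae
  rw [Measure.restrict_apply' hU.measurableSet, inter_comm] at hnull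
  exact hpos.ne' hnull

/-- **Essentially bounded and continuous on an open set ⇒ bounded**: if `g` is continuous on the
open set `U` and `‖g‖_{L^∞(U, μ)} < ∞`, then `‖g x‖ ≤ ‖g‖_{L^∞(U)}.toReal` for all `x ∈ U`.
[folklore] -/
theorem exists_forall_norm_le_of_eLpNorm_top_lt_top {U : Set X} (hU : IsOpen U) {g : X → F}
    (hg : ContinuousOn g U) (hfin : eLpNorm g ⊤ (μ.restrict U) < ⊤) :
    ∀ x ∈ U, ‖g x‖ ≤ (eLpNorm g ⊤ (μ.restrict U)).toReal := by
  intro x hx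
  have h := enorm_le_eLpNorm_top_restrict_of_continuousOn (μ := μ) hU hg hx
  rw [← ofReal_norm] at h
  exact (ENNReal.ofReal_le_iff_le_toReal hfin.ne).1 h

end EssSup

/-! ### Classical solutions in the unit cylinder -/

section Cylinder

/-- **Classical solutions in the open unit cylinder with the three global classes are suitable
weak solutions in the parabolic ball** (`IsSuitableWeakSolutionInBall 1 0`, Albritton–Barker
2019, Def. 2.1): the interior conditions (distributional equations, local classes, local energy
inequality) hold for every classical solution
(`IsClassicalNSSolutionOnRegion.isSuitableWeakSolutionOn`), the weak gradient is the classical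
one, and the global classes `sup_t ∫_{B₁}|v|² ≤ C`, `∫∫_Q |∇v|² < ∞`, `q ∈ L^{3/2}(Q)` are the
hypotheses. [cite: AlbrittonBarker2019, Def. 2.1] -/
theorem isSuitableWeakSolutionInBall_of_classical
    {v : ℝ → EuclideanSpace ℝ (Fin 3) → EuclideanSpace ℝ (Fin 3)}
    {q : ℝ → EuclideanSpace ℝ (Fin 3) → ℝ}
    (hv : IsClassicalNSSolutionOnRegion
      (parabolicCylinder 1 (0 : ℝ × EuclideanSpace ℝ (Fin 3))) 1 0 v q)
    {C : ℝ≥0} (hC : ∀ t ∈ Ioo (-1 : ℝ) 0,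
      ∫⁻ x in ball (0 : EuclideanSpace ℝ (Fin 3)) 1, ‖v t x‖ₑ ^ 2 ≤ C)
    (hG : ∫⁻ w in parabolicCylinder 1 (0 : ℝ × EuclideanSpace ℝ (Fin 3)),
      ENNReal.ofReal (frobeniusNormSq (fderiv ℝ (v w.1) w.2)) < ⊤)
    (hq : MemLp (uncurry q) (3 / 2)
      (volume.restrict (parabolicCylinder 1 (0 : ℝ × EuclideanSpace ℝ (Fin 3))))) :
    IsSuitableWeakSolutionInBall 1 0 v q := by
  refine ⟨?_, ⟨C, ?_⟩, ⟨fun t x => fderiv ℝ (v t) x, ?_, hG⟩, hq⟩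
  · exact hv.isSuitableWeakSolutionOn (isOpen_parabolicCylinder 1 0) one_pos
  · refine (ae_restrict_iff' measurableSet_Ioo).2 (ae_of_all _ fun t ht => ?_)
    have ht' : t ∈ Ioo (-1 : ℝ) 0 := by simpa using ht
    simpa using hC t ht'
  · exact hv.hasWeakSpatialGradientOn (isOpen_parabolicCylinder 1 0) subset_rfl

/-- **Regularity at the top centre of the cylinder for classical solutions with small
dissipation** (the CKN criterion, backward form, Seregin 2014, Ch. 6, Thm. 1.4, via the tree's
`seregin2014_thm14_holds`): there is a universal `ε > 0` such that every classical solution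
`(v, q)` of the unforced Navier–Stokes system (`ν = 1`) on the open unit cylinder
`Q = (−1,0) × B₁ ⊆ ℝ × ℝ³` with `sup_t ∫_{B₁}|v(t)|² ≤ C`, `∫∫_Q |∇v|² < ∞`, `q ∈ L^{3/2}(Q)`
and `sup_{0<r<1} r⁻¹ ∫∫_{Q(r)} |∇v|² < ε` (classical gradient) is **bounded** on some cylinder
`Q(ϱ) = (−ϱ², 0) × B_ϱ`, `0 < ϱ < 1`: `‖v(t, x)‖ ≤ M` there. (Essential boundedness from the
criterion; pointwise by continuity on the open cylinder.) This is the invocation of "[11]" in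
Pineau–Vicol 2026, proof of Prop. 9.5. [cite: Seregin2014, Ch. 6 §6.1 Theorem 1.4, PDF p. 94] -/
theorem exists_bound_near_top_of_classical_of_cknE_lt :
    ∃ ε : ℝ, 0 < ε ∧
      ∀ (v : ℝ → EuclideanSpace ℝ (Fin 3) → EuclideanSpace ℝ (Fin 3))
        (q : ℝ → EuclideanSpace ℝ (Fin 3) → ℝ),
        IsClassicalNSSolutionOnRegion
          (parabolicCylinder 1 (0 : ℝ × EuclideanSpace ℝ (Fin 3))) 1 0 v q →
        (∃ C : ℝ≥0, ∀ t ∈ Ioo (-1 : ℝ) 0,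
          ∫⁻ x in ball (0 : EuclideanSpace ℝ (Fin 3)) 1, ‖v t x‖ₑ ^ 2 ≤ C) →
        (∫⁻ w in parabolicCylinder 1 (0 : ℝ × EuclideanSpace ℝ (Fin 3)),
          ENNReal.ofReal (frobeniusNormSq (fderiv ℝ (v w.1) w.2)) < ⊤) →
        MemLp (uncurry q) (3 / 2)
          (volume.restrict (parabolicCylinder 1 (0 : ℝ × EuclideanSpace ℝ (Fin 3)))) →
        (⨆ r ∈ Ioo (0 : ℝ) 1,
          cknE r (0 : ℝ × EuclideanSpace ℝ (Fin 3)) (fun t x => fderiv ℝ (v t) x)) <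
            ENNReal.ofReal ε →
        ∃ ϱ ∈ Ioo (0 : ℝ) 1, ∃ M : ℝ,
          ∀ w ∈ parabolicCylinder ϱ (0 : ℝ × EuclideanSpace ℝ (Fin 3)), ‖v w.1 w.2‖ ≤ M := by
  obtain ⟨ε, hε, H⟩ := seregin2014_thm14_holds
  refine ⟨ε, hε, fun v q hv hC hG hq hE => ?_⟩
  obtain ⟨C, hC⟩ := hC
  have hsuit := isSuitableWeakSolutionInBall_of_classical hv hC hG hq
  obtain ⟨ϱ, hϱ, hfin⟩ := H v q hsuit
    ⟨fun t x => fderiv ℝ (v t) x,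
      hv.hasWeakSpatialGradientOn (isOpen_parabolicCylinder 1 0) (by
        simp only [coe_parabolicCylinderOpens]; exact subset_rfl), hE⟩
  refine ⟨ϱ, hϱ, (eLpNorm (uncurry v) ⊤
    (volume.restrict (parabolicCylinder ϱ (0 : ℝ × EuclideanSpace ℝ (Fin 3))))).toReal, ?_⟩
  -- continuity of `v` on the smaller (open) cylinder, inside the unit one
  have hsub : parabolicCylinder ϱ (0 : ℝ × EuclideanSpace ℝ (Fin 3)) ⊆
      parabolicCylinder 1 (0 : ℝ × EuclideanSpace ℝ (Fin 3)) := by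
    intro w hw
    simp only [mem_parabolicCylinder] at hw ⊢
    have h1 : ϱ ^ 2 ≤ 1 := by nlinarith [hϱ.1, hϱ.2]
    exact ⟨⟨by linarith [hw.1.1], hw.1.2⟩, hw.2.trans hϱ.2⟩
  have hcont : ContinuousOn (uncurry v) (parabolicCylinder ϱ (0 : ℝ × EuclideanSpace ℝ (Fin 3))) :=
    hv.smooth_velocity.continuousOn.mono hsub
  intro w hw
  exact exists_forall_norm_le_of_eLpNorm_top_lt_top (isOpen_parabolicCylinder ϱ 0) hcont hfin w hw

end Cylinder

end Literature.Analysis.FluidPDE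

end
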